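import Summits.BirchSwinnertonDyer.Rank1Residual.X2.TorsionComparison
import Summits.BirchSwinnertonDyer.Rank1Residual.X2.ResidualDevissage
import HarnessLib

/-!
# The connecting homomorphism `δ : Ψ^G → H¹(G, Φ)` of a short exact sequence
# `0 → Φ → M → Ψ → 0` of discrete `G`-modules, and the exactness of
# `M^G → Ψ^G →δ H¹(G, Φ) → H¹(G, M)` (cell `b2b-bsdres`, unit `b2b-bsdres-eisenstein-p2`, gen 24;
# generic continuous group cohomology — the two-module generalisation of gen 8's
# `X2/TorsionComparison.lean`, companion of gen 16's `X2/ResidualDevissage.lean`)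

HONEST FRAMING (run/shared/lean/b2b/bsd-rank1-residual/, verbatim in every file): the goal of the
cell is to DELETE the COMBINATION-SHAPED residual classes of the Birch–Swinnerton-Dyer formula for
ALL analytic-rank `≤ 1` elliptic curves over `ℚ` — "full BSD formula for every rank `≤ 1` curve in
class `C`" assembled STRICTLY from published theorems — so that the rank-`≤ 1` remainder becomes
exactly the CONSTRUCTION-SHAPED classes, which are TYPED (missing-input `Prop`s), NOT attempted.
This is not "finishing BSD". Research route; NO CLAIM BEYOND STATED CLASSES; nothing here changes a
label. This file is GENERIC continuous group cohomology (no number theory): every declaration is a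
definition with a body or a proved theorem; no named fact.

WHY. Gen 8 (`TorsionComparison`) built `δ` for `0 → M[n] → M →ⁿ M → 0`; gen 16 (`ResidualDevissage`)
proved exactness of `H¹(G, Φ) → H¹(G, M) → H¹(G, Ψ)`. The remaining low-degree piece — `δ : Ψ^G →
H¹(G, Φ)` with `ker δ = q(M^G)`, `im δ = ker i_*` — is what Kummer theory of an ISOGENY `φ : E → E'`
needs (`Φ = E[φ]`, `M = E(K̄)`, `Ψ = E'(K̄)`: `E'(K)/φ(E(K)) ≅ ker(H¹(K, E[φ]) → H¹(K, E))`,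
Silverman *AEC* X.4.1–4.2), the landing spot for `p`-isogeny-descent certificates (X2-LEDGER §3).

CONTENT. `i : Φ →+ M` equivariant injective, `q : M →+ Ψ` equivariant surjective, `ker q = im i`
(`hexact`, `hqi`), `M` with continuous orbit maps (`hM`). §1 `sesCocycle b` (`g ↦ i⁻¹(g•b − b)` for
`q b ∈ Ψ^G`; `i ∘ sesCocycle b = ∂b`; independence of the lift; additivity). §2 **`delta`**,
`delta_apply_of_eq`, `pushH1_delta`, **`range_delta_eq_ker`** (`im δ = ker i_*`),
**`mem_ker_delta_iff`** / `ker_delta_eq` (`ker δ = q(M^G)`), **`kerEquiv : Ψ^G ⧸ q(M^G) ≃+ ker i_*`**.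
§3 `natCard_ker_pushH1_eq` (`#ker i_* = #(Ψ^G ⧸ q(M^G))`).

References: Serre, *Galois Cohomology*, I.§2.2–2.4, I.§5.1 (Prop. 36: the exact hexagon in low
degree); Neukirch–Schmidt–Wingberg (1.3.2); Silverman, *AEC*, VIII.§2, X.4.1–X.4.2 (the Kummer
sequence of an isogeny).
-/

noncomputable section
open scoped Classical AddSubgroup
universe u

namespace Summit.BirchSwinnertonDyer.Rank1Residual.X2.ConnectingHomomorphism

open Literature.NumberTheory.EllipticCurves Literature.NumberTheory.GaloisRepresentations
  Summit.BirchSwinnertonDyer.Rank1Residual.X2.TorsionComparison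

variable {G : Type u} [Group G] [TopologicalSpace G] [IsTopologicalGroup G]
variable {Φ : Type u} [AddCommGroup Φ] [DistribMulAction G Φ] [TopologicalSpace Φ]
  [DiscreteTopology Φ]
variable {M : Type u} [AddCommGroup M] [DistribMulAction G M] [TopologicalSpace M]
  [DiscreteTopology M]
variable {Ψ : Type u} [AddCommGroup Ψ] [DistribMulAction G Ψ]

variable {i : Φ →+ M} {hi : ∀ (g : G) (x : Φ), i (ContinuousMonoidHom.id G g • x) = g • i x}
  {q : M →+ Ψ}

/-! ## §1. The `Φ`-valued cocycle of a lift -/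

section Cocycle

omit [TopologicalSpace G] [IsTopologicalGroup G] [DistribMulAction G Φ] [TopologicalSpace Φ]
  [DiscreteTopology Φ] [TopologicalSpace M] [DiscreteTopology M] in
/-- For `b ∈ M` with `q b` fixed by `G`, every `g • b − b` lies in `ker q = im i`. [folklore] -/
theorem smul_sub_mem_range (hq : ∀ (g : G) (m : M), q (g • m) = g • q m)
    (hexact : ∀ m, q m = 0 → m ∈ i.range) (b : M) (hb : q b ∈ invariants G Ψ) (g : G) :
    g • b - b ∈ i.range :=
  hexact _ (by rw [map_sub, hq, (mem_invariants_iff (q b)).1 hb g, sub_self])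

/-- A chosen `i`-preimage of `g • b − b` (for `q b ∈ Ψ^G`). [folklore] -/
def sesLift (hq : ∀ (g : G) (m : M), q (g • m) = g • q m)
    (hexact : ∀ m, q m = 0 → m ∈ i.range) (b : M) (hb : q b ∈ invariants G Ψ) (g : G) : Φ :=
  Classical.choose (AddMonoidHom.mem_range.1 (smul_sub_mem_range hq hexact b hb g))

omit [TopologicalSpace G] [IsTopologicalGroup G] [DistribMulAction G Φ] [TopologicalSpace Φ]
  [DiscreteTopology Φ] [TopologicalSpace M] [DiscreteTopology M] in
/-- `i (sesLift b g) = g • b − b`. [folklore] -/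
@[simp]
theorem i_sesLift (hq : ∀ (g : G) (m : M), q (g • m) = g • q m)
    (hexact : ∀ m, q m = 0 → m ∈ i.range) (b : M) (hb : q b ∈ invariants G Ψ) (g : G) :
    i (sesLift hq hexact b hb g) = g • b - b :=
  Classical.choose_spec (AddMonoidHom.mem_range.1 (smul_sub_mem_range hq hexact b hb g))

/-- **The `Φ`-valued cocycle `g ↦ i⁻¹(g • b − b)` of `b ∈ M` with `q b ∈ Ψ^G`**: the coboundary of
`b` lifted along the injection `i`. Serre, *Galois Cohomology*, I.§5.1. [folklore] -/
def sesCocycle (hM : ∀ m : M, Continuous fun g : G ↦ g • m)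
    (hq : ∀ (g : G) (m : M), q (g • m) = g • q m) (hinj : Function.Injective i)
    (hexact : ∀ m, q m = 0 → m ∈ i.range) (b : M) (hb : q b ∈ invariants G Ψ) :
    contOneCocycles (discreteTopRep G Φ) :=
  contOneCocycles.lift i hi hinj (cobCocycle b (hM b)) (sesLift hq hexact b hb)
    (fun g ↦ by rw [i_sesLift, cobCocycle_apply])

omit [IsTopologicalGroup G] in
/-- Values of `sesCocycle` under `i`: `i ((sesCocycle b) g) = g • b − b`. [folklore] -/
@[simp]
theorem i_sesCocycle_apply (hM : ∀ m : M, Continuous fun g : G ↦ g • m)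
    (hq : ∀ (g : G) (m : M), q (g • m) = g • q m) (hinj : Function.Injective i)
    (hexact : ∀ m, q m = 0 → m ∈ i.range) (b : M) (hb : q b ∈ invariants G Ψ) (g : G) :
    i ((sesCocycle (hi := hi) hM hq hinj hexact b hb).1 g) = g • b - b :=
  i_sesLift hq hexact b hb g

omit [IsTopologicalGroup G] in
/-- `i ∘ sesCocycle b = ∂b`. [folklore] -/
theorem push_sesCocycle (hM : ∀ m : M, Continuous fun g : G ↦ g • m)
    (hq : ∀ (g : G) (m : M), q (g • m) = g • q m) (hinj : Function.Injective i)
    (hexact : ∀ m, q m = 0 → m ∈ i.range) (b : M) (hb : q b ∈ invariants G Ψ) :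
    contOneCocycles.push i hi (sesCocycle (hi := hi) hM hq hinj hexact b hb) = cobCocycle b (hM b) :=
  contOneCocycles.push_lift _ _ _ _ _ _

/-- `i_* [sesCocycle b] = 0` (its image in `H¹(G, M)` is the class of a coboundary). [folklore] -/
theorem pushH1_sesClass (hM : ∀ m : M, Continuous fun g : G ↦ g • m)
    (hq : ∀ (g : G) (m : M), q (g • m) = g • q m) (hinj : Function.Injective i)
    (hexact : ∀ m, q m = 0 → m ∈ i.range) (b : M) (hb : q b ∈ invariants G Ψ) :
    resH1Hom (ContinuousMonoidHom.id G) i hi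
        (oneCocycleClass _ (sesCocycle (hi := hi) hM hq hinj hexact b hb)) = 0 := by
  rw [ResidualDevissage.pushH1_oneCocycleClass, push_sesCocycle, oneCocycleClass_cobCocycle]

omit [IsTopologicalGroup G] in
include hi in
/-- Continuity of the orbit maps of `Φ` (from those of `M`, through the injection `i`).
[folklore] -/
theorem continuous_smul_of_injective (hM : ∀ m : M, Continuous fun g : G ↦ g • m)
    (hinj : Function.Injective i) (x : Φ) : Continuous fun g : G ↦ g • x :=
  continuous_of_injective_comp hinj (by
    have hi' : ∀ (g : G) (x : Φ), i (g • x) = g • i x := hi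
    have h : i ∘ (fun g : G ↦ g • x) = fun g : G ↦ g • i x := funext fun g ↦ hi' g x
    rw [h]
    exact hM (i x))

omit [IsTopologicalGroup G] in
/-- **`sesCocycle` is additive in the lift**: `sesCocycle (b + b') = sesCocycle b + sesCocycle b'`
(compare values under the injection `i`). [folklore] -/
theorem sesCocycle_add (hM : ∀ m : M, Continuous fun g : G ↦ g • m)
    (hq : ∀ (g : G) (m : M), q (g • m) = g • q m) (hinj : Function.Injective i)
    (hexact : ∀ m, q m = 0 → m ∈ i.range) (b b' : M) (hb : q b ∈ invariants G Ψ)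
    (hb' : q b' ∈ invariants G Ψ) (hbb' : q (b + b') ∈ invariants G Ψ) :
    sesCocycle (hi := hi) hM hq hinj hexact (b + b') hbb' =
      sesCocycle (hi := hi) hM hq hinj hexact b hb + sesCocycle (hi := hi) hM hq hinj hexact b' hb' := by
  apply Subtype.ext
  ext g
  apply hinj
  change i ((sesCocycle (hi := hi) hM hq hinj hexact (b + b') hbb').1 g) =
    i ((sesCocycle (hi := hi) hM hq hinj hexact b hb).1 g +
      (sesCocycle (hi := hi) hM hq hinj hexact b' hb').1 g)
  rw [map_add, i_sesCocycle_apply, i_sesCocycle_apply, i_sesCocycle_apply, smul_add]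
  abel

/-- **The class of `sesCocycle b` vanishes when `b ∈ im i`** (then `q b = 0` and the cocycle is the
coboundary, inside `Φ`, of the preimage of `b`). [folklore] -/
theorem sesClass_eq_zero_of_mem_range (hM : ∀ m : M, Continuous fun g : G ↦ g • m)
    (hq : ∀ (g : G) (m : M), q (g • m) = g • q m) (hinj : Function.Injective i)
    (hexact : ∀ m, q m = 0 → m ∈ i.range) (t : Φ) (ht : q (i t) ∈ invariants G Ψ) :
    oneCocycleClass _ (sesCocycle (hi := hi) hM hq hinj hexact (i t) ht) = 0 := by
  have hi' : ∀ (g : G) (x : Φ), i (g • x) = g • i x := hi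
  have e : sesCocycle (hi := hi) hM hq hinj hexact (i t) ht =
      cobCocycle t (continuous_smul_of_injective (hi := hi) hM hinj t) := by
    apply Subtype.ext; ext g
    apply hinj
    change i ((sesCocycle (hi := hi) hM hq hinj hexact (i t) ht).1 g) = i (g • t - t)
    rw [i_sesCocycle_apply, map_sub, hi']
  rw [e, oneCocycleClass_cobCocycle]

/-- **Independence of the lift**: if `q b = q b'` (both fixed) then `[sesCocycle b] = [sesCocycle b']`
(`b − b' ∈ ker q = im i`, and the difference of the cocycles is a coboundary in `Φ`). [folklore] -/
theorem sesClass_eq_of_q_eq (hM : ∀ m : M, Continuous fun g : G ↦ g • m)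
    (hq : ∀ (g : G) (m : M), q (g • m) = g • q m) (hinj : Function.Injective i)
    (hexact : ∀ m, q m = 0 → m ∈ i.range) (b b' : M) (hb : q b ∈ invariants G Ψ)
    (hb' : q b' ∈ invariants G Ψ) (h : q b = q b') :
    oneCocycleClass _ (sesCocycle (hi := hi) hM hq hinj hexact b hb) =
      oneCocycleClass _ (sesCocycle (hi := hi) hM hq hinj hexact b' hb') := by
  -- `b - b' = i t`
  obtain ⟨t, ht⟩ := AddMonoidHom.mem_range.1 (hexact (b - b') (by rw [map_sub, h, sub_self]))
  have hneg : q (-b') ∈ invariants G Ψ := by rw [map_neg]; exact neg_mem hb'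
  have hit : q (i t) ∈ invariants G Ψ := by
    rw [ht, map_sub, h, sub_self]; exact zero_mem _
  have hdiff : q (b + -b') ∈ invariants G Ψ := by
    rw [← sub_eq_add_neg, ← ht]; exact hit
  have e1 : sesCocycle (hi := hi) hM hq hinj hexact b hb =
      sesCocycle (hi := hi) hM hq hinj hexact (b + -b') hdiff +
        sesCocycle (hi := hi) hM hq hinj hexact b' hb' := by
    apply Subtype.ext; ext g
    apply hinj
    change i ((sesCocycle (hi := hi) hM hq hinj hexact b hb).1 g) =
      i ((sesCocycle (hi := hi) hM hq hinj hexact (b + -b') hdiff).1 g +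
        (sesCocycle (hi := hi) hM hq hinj hexact b' hb').1 g)
    rw [map_add, i_sesCocycle_apply, i_sesCocycle_apply, i_sesCocycle_apply, smul_add, smul_neg]
    abel
  have e2 : oneCocycleClass _ (sesCocycle (hi := hi) hM hq hinj hexact (b + -b') hdiff) = 0 := by
    have hbt : b + -b' = i t := by rw [← sub_eq_add_neg, ht]
    have key : ∀ (c : M) (hc : q c ∈ invariants G Ψ) (hc' : c = i t),
        oneCocycleClass _ (sesCocycle (hi := hi) hM hq hinj hexact c hc) = 0 := by
      intro c hc hc'
      subst hc'
      exact sesClass_eq_zero_of_mem_range hM hq hinj hexact t hc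
    exact key _ hdiff hbt
  rw [e1, oneCocycleClass_add, e2, zero_add]

end Cocycle

/-! ## §2. The connecting homomorphism `δ : Ψ^G → H¹(G, Φ)` -/

section Delta

/-- A chosen `q`-preimage (for `q` surjective). [folklore] -/
def qLift (hsurj : Function.Surjective q) (y : Ψ) : M :=
  Classical.choose (hsurj y)

omit [TopologicalSpace G] [IsTopologicalGroup G] [DistribMulAction G M] [TopologicalSpace M]
  [DiscreteTopology M] [DistribMulAction G Ψ] in
/-- `q (qLift y) = y`. [folklore] -/
@[simp]
theorem q_qLift (hsurj : Function.Surjective q) (y : Ψ) : q (qLift hsurj y) = y :=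
  Classical.choose_spec (hsurj y)

omit [TopologicalSpace G] [IsTopologicalGroup G] [DistribMulAction G M] [TopologicalSpace M]
  [DiscreteTopology M] in
/-- `q (qLift y) ∈ Ψ^G` for `y ∈ Ψ^G`. [folklore] -/
theorem q_qLift_mem (hsurj : Function.Surjective q) (y : invariants G Ψ) :
    q (qLift hsurj (y : Ψ)) ∈ invariants G Ψ := by
  rw [q_qLift]; exact y.2

variable (G Φ) in
/-- **The connecting homomorphism `δ : Ψ^G → H¹(G, Φ)`** of the short exact sequence
`0 → Φ →i M →q Ψ → 0` of discrete `G`-modules (`M` with continuous orbit maps):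
`δ(y) = [g ↦ i⁻¹(g • b − b)]` for any `b` with `q b = y` (well defined by `sesClass_eq_of_q_eq`).
Serre, *Galois Cohomology*, I.§5.1, Prop. 36; NSW (1.3.2). [folklore] -/
def delta (hM : ∀ m : M, Continuous fun g : G ↦ g • m)
    (hq : ∀ (g : G) (m : M), q (g • m) = g • q m) (hinj : Function.Injective i)
    (hsurj : Function.Surjective q) (hexact : ∀ m, q m = 0 → m ∈ i.range) :
    invariants G Ψ →+ discreteH1 G Φ where
  toFun y := oneCocycleClass _
    (sesCocycle (hi := hi) hM hq hinj hexact (qLift hsurj (y : Ψ)) (q_qLift_mem hsurj y))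
  map_zero' := by
    have h0 : q (i 0) ∈ invariants G Ψ := by rw [map_zero, map_zero]; exact zero_mem _
    rw [sesClass_eq_of_q_eq hM hq hinj hexact _ (i 0) (q_qLift_mem hsurj 0) h0
      (by rw [q_qLift, map_zero, map_zero]; rfl)]
    exact sesClass_eq_zero_of_mem_range hM hq hinj hexact 0 h0
  map_add' y y' := by
    have hsum : q (qLift hsurj (y : Ψ) + qLift hsurj (y' : Ψ)) ∈ invariants G Ψ := by
      rw [map_add, q_qLift, q_qLift]; exact add_mem y.2 y'.2
    rw [sesClass_eq_of_q_eq hM hq hinj hexact _ _ (q_qLift_mem hsurj (y + y')) hsum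
      (by rw [q_qLift, map_add, q_qLift, q_qLift]; rfl),
      sesCocycle_add hM hq hinj hexact _ _ (q_qLift_mem hsurj y) (q_qLift_mem hsurj y'),
      oneCocycleClass_add]

/-- **`δ(q b) = [sesCocycle b]` for ANY lift `b`** (not just the chosen one). [folklore] -/
theorem delta_apply_of_eq (hM : ∀ m : M, Continuous fun g : G ↦ g • m)
    (hq : ∀ (g : G) (m : M), q (g • m) = g • q m) (hinj : Function.Injective i)
    (hsurj : Function.Surjective q) (hexact : ∀ m, q m = 0 → m ∈ i.range)
    (b : M) (hb : q b ∈ invariants G Ψ) :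
    delta G Φ (hi := hi) hM hq hinj hsurj hexact ⟨q b, hb⟩ =
      oneCocycleClass _ (sesCocycle (hi := hi) hM hq hinj hexact b hb) :=
  sesClass_eq_of_q_eq hM hq hinj hexact _ b (q_qLift_mem hsurj _) hb (by rw [q_qLift])

/-- `i_* ∘ δ = 0`. Serre, *Galois Cohomology*, I.§5.1. [folklore] -/
theorem pushH1_delta (hM : ∀ m : M, Continuous fun g : G ↦ g • m)
    (hq : ∀ (g : G) (m : M), q (g • m) = g • q m) (hinj : Function.Injective i)
    (hsurj : Function.Surjective q) (hexact : ∀ m, q m = 0 → m ∈ i.range) (y : invariants G Ψ) :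
    resH1Hom (ContinuousMonoidHom.id G) i hi (delta G Φ (hi := hi) hM hq hinj hsurj hexact y) = 0 :=
  pushH1_sesClass hM hq hinj hexact _ _

/-- **Exactness at `H¹(G, Φ)`: `im δ = ker i_*`.** A class `[f]` with `[i ∘ f] = 0` has
`i ∘ f = ∂v` for some `v ∈ M`; then `q v ∈ Ψ^G` and `f = sesCocycle v`, so `[f] = δ(q v)`.
Serre, *Galois Cohomology*, I.§5.1, Prop. 36. [folklore] -/
theorem range_delta_eq_ker (hM : ∀ m : M, Continuous fun g : G ↦ g • m)
    (hq : ∀ (g : G) (m : M), q (g • m) = g • q m) (hinj : Function.Injective i)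
    (hsurj : Function.Surjective q) (hexact : ∀ m, q m = 0 → m ∈ i.range)
    (hqi : ∀ x, q (i x) = 0) :
    (delta G Φ (hi := hi) hM hq hinj hsurj hexact).range =
      (resH1Hom (ContinuousMonoidHom.id G) i hi).ker := by
  ext c
  constructor
  · rintro ⟨y, rfl⟩
    exact (AddMonoidHom.mem_ker).2 (pushH1_delta hM hq hinj hsurj hexact y)
  · intro hc
    obtain ⟨f, rfl⟩ := classHom_surjective (G := G) (M := Φ) c
    rw [AddMonoidHom.mem_ker, classHom_apply, ResidualDevissage.pushH1_oneCocycleClass,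
      oneCocycleClass_eq_zero_iff] at hc
    obtain ⟨v, hv⟩ := hc
    have hv' : ∀ g : G, i (f.1 g) = g • v - v := hv
    -- `q v` is `G`-fixed
    have hqv : q v ∈ invariants G Ψ := by
      rw [mem_invariants_iff]
      intro g
      rw [← sub_eq_zero, ← hq, ← map_sub, ← hv' g, hqi]
    refine ⟨⟨q v, hqv⟩, ?_⟩
    rw [delta_apply_of_eq hM hq hinj hsurj hexact v hqv, classHom_apply]
    congr 1
    apply Subtype.ext; ext g
    apply hinj
    rw [i_sesCocycle_apply, hv' g]

/-- **`ker δ = q(M^G)`**: `δ(y) = 0` iff `y = q m` for some INVARIANT `m`. (If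
`[sesCocycle b] = 0`, `i⁻¹(g • b − b) = g • t − t` for some `t ∈ Φ`, so `m = b − i t ∈ M^G` and
`q m = q b = y`.) Serre, *Galois Cohomology*, I.§5.1 (exactness at `H⁰(G, A'')`). [folklore] -/
theorem mem_ker_delta_iff (hM : ∀ m : M, Continuous fun g : G ↦ g • m)
    (hq : ∀ (g : G) (m : M), q (g • m) = g • q m) (hinj : Function.Injective i)
    (hsurj : Function.Surjective q) (hexact : ∀ m, q m = 0 → m ∈ i.range)
    (hqi : ∀ x, q (i x) = 0) (y : invariants G Ψ) :
    y ∈ (delta G Φ (hi := hi) hM hq hinj hsurj hexact).ker ↔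
      ∃ m ∈ invariants G M, q m = (y : Ψ) := by
  have hi' : ∀ (g : G) (x : Φ), i (g • x) = g • i x := hi
  rw [AddMonoidHom.mem_ker]
  constructor
  · intro h
    set b := qLift hsurj (y : Ψ) with hbdef
    have hb : q b = (y : Ψ) := q_qLift hsurj _
    change oneCocycleClass _ (sesCocycle (hi := hi) hM hq hinj hexact b (q_qLift_mem hsurj y)) = 0
      at h
    rw [oneCocycleClass_eq_zero_iff] at h
    obtain ⟨t, ht⟩ := h
    refine ⟨b - i t, (mem_invariants_iff _).2 fun g ↦ ?_, ?_⟩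
    · have h1 := congrArg i (ht g)
      change i ((sesCocycle (hi := hi) hM hq hinj hexact b (q_qLift_mem hsurj y)).1 g) =
        i (g • t - t) at h1
      rw [i_sesCocycle_apply, map_sub, hi'] at h1
      rw [smul_sub, sub_eq_sub_iff_sub_eq_sub, h1]
    · rw [map_sub, hqi, sub_zero, hb]
  · rintro ⟨m, hm, hmy⟩
    have hmq : q m ∈ invariants G Ψ := by rw [hmy]; exact y.2
    have ey : y = ⟨q m, hmq⟩ := Subtype.ext hmy.symm
    rw [ey, delta_apply_of_eq hM hq hinj hsurj hexact m hmq, oneCocycleClass_eq_zero_iff]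
    refine ⟨0, fun g ↦ hinj ?_⟩
    change i ((sesCocycle (hi := hi) hM hq hinj hexact m hmq).1 g) = i (g • (0 : Φ) - 0)
    rw [i_sesCocycle_apply, smul_zero, sub_zero, map_zero, (mem_invariants_iff m).1 hm g, sub_self]

variable (G) in
omit [TopologicalSpace G] [IsTopologicalGroup G] [TopologicalSpace M] [DiscreteTopology M] in
/-- `q` maps `M^G` into `Ψ^G`. [folklore] -/
theorem q_mem_invariants (hq : ∀ (g : G) (m : M), q (g • m) = g • q m) (m : invariants G M) :
    q (m : M) ∈ invariants G Ψ :=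
  (mem_invariants_iff _).2 fun g ↦ by rw [← hq, (mem_invariants_iff (m : M)).1 m.2 g]

variable (G) in
/-- `q|_{M^G} : M^G → Ψ^G`. [folklore] -/
def qOnInvariants (hq : ∀ (g : G) (m : M), q (g • m) = g • q m) :
    invariants G M →+ invariants G Ψ where
  toFun m := ⟨q (m : M), q_mem_invariants G hq m⟩
  map_zero' := Subtype.ext (by simp)
  map_add' a b := Subtype.ext (by simp)

variable (G) in
/-- `q(M^G) ≤ Ψ^G` (the image of the invariants). [folklore] -/
def qInvariants (hq : ∀ (g : G) (m : M), q (g • m) = g • q m) : AddSubgroup (invariants G Ψ) :=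
  (qOnInvariants G hq).range

omit [TopologicalSpace G] [IsTopologicalGroup G] [TopologicalSpace M] [DiscreteTopology M] in
/-- Membership in `q(M^G)`. [folklore] -/
theorem mem_qInvariants_iff (hq : ∀ (g : G) (m : M), q (g • m) = g • q m) (y : invariants G Ψ) :
    y ∈ qInvariants G hq ↔ ∃ m ∈ invariants G M, q m = (y : Ψ) := by
  constructor
  · rintro ⟨m, rfl⟩
    exact ⟨m, m.2, rfl⟩
  · rintro ⟨m, hm, hmy⟩
    exact ⟨⟨m, hm⟩, Subtype.ext hmy⟩

/-- `ker δ = q(M^G)` as subgroups. Serre, *Galois Cohomology*, I.§5.1. [folklore] -/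
theorem ker_delta_eq (hM : ∀ m : M, Continuous fun g : G ↦ g • m)
    (hq : ∀ (g : G) (m : M), q (g • m) = g • q m) (hinj : Function.Injective i)
    (hsurj : Function.Surjective q) (hexact : ∀ m, q m = 0 → m ∈ i.range)
    (hqi : ∀ x, q (i x) = 0) :
    (delta G Φ (hi := hi) hM hq hinj hsurj hexact).ker = qInvariants G hq := by
  ext y
  rw [mem_ker_delta_iff hM hq hinj hsurj hexact hqi, mem_qInvariants_iff]

/-- **`ker i_* ≅ Ψ^G ⧸ q(M^G)`** (first isomorphism theorem for `δ`, with `im δ = ker i_*`).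
For the Kummer sequence of an isogeny `φ : E → E'` over `K` (`G = Γ_K`, `M = E(K̄)`, `Ψ = E'(K̄)`,
`Φ = E[φ]`) this is `E'(K)/φ(E(K)) ≅ ker(H¹(K, E[φ]) → H¹(K, E))` (Silverman *AEC* X.4.1–4.2).
Serre, *Galois Cohomology*, I.§5.1, Prop. 36. [folklore] -/
def kerEquiv (hM : ∀ m : M, Continuous fun g : G ↦ g • m)
    (hq : ∀ (g : G) (m : M), q (g • m) = g • q m) (hinj : Function.Injective i)
    (hsurj : Function.Surjective q) (hexact : ∀ m, q m = 0 → m ∈ i.range)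
    (hqi : ∀ x, q (i x) = 0) :
    invariants G Ψ ⧸ qInvariants G hq ≃+ (resH1Hom (ContinuousMonoidHom.id G) i hi).ker :=
  ((QuotientAddGroup.quotientAddEquivOfEq (ker_delta_eq hM hq hinj hsurj hexact hqi)).symm.trans
    (QuotientAddGroup.quotientKerEquivRange (delta G Φ (hi := hi) hM hq hinj hsurj hexact))).trans
    (AddEquiv.addSubgroupCongr (range_delta_eq_ker hM hq hinj hsurj hexact hqi))

end Delta

/-! ## §3. Counting corollaries -/

section Count

/-- `#ker(i_*) = #(Ψ^G ⧸ q(M^G))`. [folklore] -/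
theorem natCard_ker_pushH1_eq (hM : ∀ m : M, Continuous fun g : G ↦ g • m)
    (hq : ∀ (g : G) (m : M), q (g • m) = g • q m) (hinj : Function.Injective i)
    (hsurj : Function.Surjective q) (hexact : ∀ m, q m = 0 → m ∈ i.range)
    (hqi : ∀ x, q (i x) = 0) :
    Nat.card (resH1Hom (ContinuousMonoidHom.id G) i hi).ker =
      Nat.card (invariants G Ψ ⧸ qInvariants G hq) :=
  (Nat.card_congr (kerEquiv (hi := hi) hM hq hinj hsurj hexact hqi).toEquiv).symm

end Count

end Summit.BirchSwinnertonDyer.Rank1Residual.X2.ConnectingHomomorphism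

end
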